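import Mathlib
import Summits.Ventures.HodgeRepro.Tier4.Target
import Summits.Ventures.HodgeRepro.Tier4.Common.AutForms
import Summits.Ventures.HodgeRepro.Tier4.Line3.KMDatum
import Summits.Ventures.HodgeRepro.Tier4.Line3.KMDatumS
import Summits.Ventures.HodgeRepro.Tier4.Line3.Defs
import Summits.Ventures.HodgeRepro.Tier4.Line3.CopyWeightGaussian
import Summits.Ventures.HodgeRepro.Tier4.Line3.HKRayReduction
import Summits.Ventures.HodgeRepro.Tier4.Line3.DatumOrthVanishing
import Summits.Ventures.HodgeRepro.Tier4.Line3.OriginRigidity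
import Summits.Ventures.HodgeRepro.Tier4.Line3.Transvection
import Summits.Ventures.HodgeRepro.Tier4.Line3.KMKernelForm
import Summits.Ventures.HodgeRepro.Tier4.Line3.KMDilation
import Summits.Ventures.HodgeRepro.Tier4.Line3.HeckeEquivarianceLemmas
import Summits.Ventures.HodgeRepro.Tier4.Line3.KernelIntegralPos
import Summits.Ventures.HodgeRepro.Tier4.Line3.SlotFunctionAlgebra
import Summits.Ventures.HodgeRepro.Tier4.Line3.ModelIntegrand
import Summits.Ventures.HodgeRepro.Tier4.Line3.ShapeIntegrandBounds
import Summits.Ventures.HodgeRepro.Tier4.Line3.ShapeIntegralBounds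
import Summits.Ventures.HodgeRepro.Tier4.Line3.DilationComparisonOfShape

/-!
# Tier4/Line3/KMShapeGlue — the Kudla–Millson kernel HAS the shape: the cut `hkRed_ray` with no analytic hypothesis

Blind re-derivation cell `pub-hodge-repro`, Tier 4 «PROVE THE STEP» (README §9–§10), LINE L3, seat t4-L3-p1 (gen 3),
self-cut C-L3-DILCOMP (bus S14565, S14686, S14694, S14707): the glue between t4-x2 g4's rigidity chain
(`OriginRigidity`, `Transvection`, `KMKernelForm`, `KMDilation`) and this seat's analysis chain (`SlotFunctionAlgebra`,
`ModelIntegrand`, `ShapeIntegrandBounds`, `ShapeIntegralBounds`, `DilationComparisonOfShape`).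

x2's `kmKernel_symm` writes the KM kernel at a symmetric centre as `|f₀ f₁|² g^{−4} |W_KM|² e^{−2π(maj₀+maj₁)}` with
`W_KM z = wedge (kmLin y₀ z) (kmLin y₁ z)`; so on the ball `kmDilInt xm α β = shapeInt y₀ y₁ W_KM α β` under `hpos`
(`kmDilInt_eq_shapeInt`, through `redMaj_eq_of_pos`).  The three shape hypotheses hold for `W_KM`: it is continuous on the
ball (`continuousOn_wedge_kmLin`), `‖W_KM‖ ≤ ‖det Y‖ + C₂/g` with `C₂ = B₁(‖y₀₀‖ + ‖y₀₁‖) + B₀(‖y₁₀‖ + ‖y₁₁‖)`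
(`norm_wedge_kmLin_le`, from the expansion `W_KM = conj(det Y) + (conj f₁ · wedge(conj y'₀, conj z) − conj f₀ ·
wedge(conj y'₁, conj z))/g`, `wedge_kmLin_eq`), and `W_KM ≠ 0` at every common zero of `f₀, f₁` (x2's
`wedge_kmLin_of_jOrth`).  Hence, for every symmetric centre `xm` with `hab` and `hpos`:

* `exists_kmDilationComparison`: `∃ A k ≥ 0, KMDilationComparison xm A k` (x2's datum-free comparison, `k = 6`);
* `exists_dilationComparison`: `∃ A k ≥ 0, DilationComparison D xm A k` for every `D : X.ThetaData` — the (HK′) clause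
  of `IsHeckeLocalisablePrintRayWSphD` is a THEOREM;
* **`hkRed_ray_of_plane`**: `∃ A k ≥ 0, ∀ n ≥ 1, MajorantMomentBoundRed D (rayCentre xm n) A k` for every `D` — the cut
  C-L3-HKRAY (plan-3 g4, S14230) with NO displayed analytic hypothesis.

(x2's displayed Laplace bounds `KMLaplaceUpper` / `KMLaplaceLower` are discharged in `Line3/KMLaplaceDischarge`.)
Imports: Mathlib and the Tier-4 modules named above, by name.  `#print axioms` of every theorem =
`[propext, Classical.choice, Quot.sound]`.  No printed input is consumed.  Nothing here asserts anything about the truth of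
(P); HC_CM is NOT proved by anyone in this repository.
-/

set_option autoImplicit false

noncomputable section

namespace Summit.Ventures.HodgeRepro.Tier4.Line3

open Summit.Ventures.HodgeRepro.Tier4
open Matrix MeasureTheory
open scoped ComplexConjugate

/-! ## The Kudla–Millson kernel has the shape: `W_KM z := wedge (kmLin y₀ z) (kmLin y₁ z)` -/

/-- The expansion of `W_KM`: `conj(det Y) + (conj f₁ · wedge(conj y'₀, conj z) − conj f₀ · wedge(conj y'₁, conj z)) / g`. -/
theorem wedge_kmLin_eq (y₀ y₁ : Fin 3 → ℂ) (z : Fin 2 → ℂ) :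
    wedge (kmLin y₀ z) (kmLin y₁ z) = conj (y₀ 0 * y₁ 1 - y₀ 1 * y₁ 0) +
      (conj (star (lift3 z) ⬝ᵥ (J *ᵥ y₁)) * (conj (y₀ 0) * conj (z 1) - conj (y₀ 1) * conj (z 0)) -
        conj (star (lift3 z) ⬝ᵥ (J *ᵥ y₀)) * (conj (y₁ 0) * conj (z 1) - conj (y₁ 1) * conj (z 0))) /
        ((1 - nsq z : ℝ) : ℂ) := by
  unfold wedge kmLin
  simp only [Fin.castSucc_zero, Fin.castSucc_one, map_sub, map_mul]
  ring

/-- Each coordinate of `kmLin y` is continuous on the ball. -/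
theorem continuousOn_kmLin (y : Fin 3 → ℂ) (l : Fin 2) : ContinuousOn (fun z => kmLin y z l) ball := by
  unfold kmLin
  have hg : ContinuousOn (fun z : Fin 2 → ℂ => ((1 - nsq z : ℝ) : ℂ)) ball :=
    (Complex.continuous_ofReal.comp (continuous_const.sub continuous_nsq)).continuousOn
  have hg0 : ∀ z ∈ ball, ((1 - nsq z : ℝ) : ℂ) ≠ 0 := fun z hz => by
    have : nsq z < 1 := hz
    exact_mod_cast (show (1 - nsq z : ℝ) ≠ 0 by linarith)
  have hf : ContinuousOn (fun z : Fin 2 → ℂ => conj (star (lift3 z) ⬝ᵥ (J *ᵥ y))) ball :=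
    (Complex.continuous_conj.comp (continuous_jform_lift3 y)).continuousOn
  have hz : ContinuousOn (fun z : Fin 2 → ℂ => conj (z l)) ball :=
    (Complex.continuous_conj.comp (continuous_apply l)).continuousOn
  exact continuousOn_const.add ((hf.div hg hg0).mul hz)

/-- `W_KM` is continuous on the ball. -/
theorem continuousOn_wedge_kmLin (y₀ y₁ : Fin 3 → ℂ) :
    ContinuousOn (fun z => wedge (kmLin y₀ z) (kmLin y₁ z)) ball := by
  have h := fun (y : Fin 3 → ℂ) (l : Fin 2) => continuousOn_kmLin y l
  exact ((h y₀ 0).mul (h y₁ 1)).sub ((h y₀ 1).mul (h y₁ 0))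

/-- The bound `‖W_KM z‖ ≤ ‖det Y‖ + C₂ / g(z)` on the ball, with
`C₂ = B₁ (‖y₀ 0‖ + ‖y₀ 1‖) + B₀ (‖y₁ 0‖ + ‖y₁ 1‖)`, `B_j = ‖y_j 0‖ + ‖y_j 1‖ + ‖y_j 2‖`. -/
theorem norm_wedge_kmLin_le (y₀ y₁ : Fin 3 → ℂ) {z : Fin 2 → ℂ} (hz : z ∈ ball) :
    ‖wedge (kmLin y₀ z) (kmLin y₁ z)‖ ≤ ‖y₀ 0 * y₁ 1 - y₀ 1 * y₁ 0‖ +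
      ((‖y₁ 0‖ + ‖y₁ 1‖ + ‖y₁ 2‖) * (‖y₀ 0‖ + ‖y₀ 1‖) + (‖y₀ 0‖ + ‖y₀ 1‖ + ‖y₀ 2‖) * (‖y₁ 0‖ + ‖y₁ 1‖)) /
        (1 - nsq z) := by
  rw [wedge_kmLin_eq]
  have hgpos : 0 < 1 - nsq z := by have : nsq z < 1 := hz; linarith
  have hz0 := norm_apply_le_one_of_mem_ball hz 0
  have hz1 := norm_apply_le_one_of_mem_ball hz 1
  have hf0 := norm_jform_lift3_le y₀ hz
  have hf1 := norm_jform_lift3_le y₁ hz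
  have hw : ∀ y : Fin 3 → ℂ, ‖conj (y 0) * conj (z 1) - conj (y 1) * conj (z 0)‖ ≤ ‖y 0‖ + ‖y 1‖ := by
    intro y
    calc ‖conj (y 0) * conj (z 1) - conj (y 1) * conj (z 0)‖
        ≤ ‖conj (y 0) * conj (z 1)‖ + ‖conj (y 1) * conj (z 0)‖ := norm_sub_le _ _
      _ = ‖y 0‖ * ‖z 1‖ + ‖y 1‖ * ‖z 0‖ := by
          rw [norm_mul, norm_mul, Complex.norm_conj, Complex.norm_conj, Complex.norm_conj, Complex.norm_conj]
      _ ≤ ‖y 0‖ * 1 + ‖y 1‖ * 1 := by gcongr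
      _ = ‖y 0‖ + ‖y 1‖ := by ring
  have hnum : ‖conj (star (lift3 z) ⬝ᵥ (J *ᵥ y₁)) * (conj (y₀ 0) * conj (z 1) - conj (y₀ 1) * conj (z 0)) -
      conj (star (lift3 z) ⬝ᵥ (J *ᵥ y₀)) * (conj (y₁ 0) * conj (z 1) - conj (y₁ 1) * conj (z 0))‖ ≤
      (‖y₁ 0‖ + ‖y₁ 1‖ + ‖y₁ 2‖) * (‖y₀ 0‖ + ‖y₀ 1‖) + (‖y₀ 0‖ + ‖y₀ 1‖ + ‖y₀ 2‖) * (‖y₁ 0‖ + ‖y₁ 1‖) := by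
    refine (norm_sub_le _ _).trans ?_
    rw [norm_mul, norm_mul, Complex.norm_conj, Complex.norm_conj]
    gcongr
    · exact hw y₀
    · exact hw y₁
  refine (norm_add_le _ _).trans ?_
  rw [Complex.norm_conj, norm_div, Complex.norm_real, Real.norm_eq_abs, abs_of_pos hgpos]
  gcongr

/-- `W_KM ≠ 0` at every common zero of `f₀, f₁` (there `W_KM = conj(det Y)`, x2's `wedge_kmLin_of_jOrth`). -/
theorem wedge_kmLin_ne_zero_of_jOrth {y₀ y₁ : Fin 3 → ℂ} (hab : y₀ 0 * y₁ 1 - y₀ 1 * y₁ 0 ≠ 0) {z : Fin 2 → ℂ}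
    (h0 : star (lift3 z) ⬝ᵥ (J *ᵥ y₀) = 0) (h1 : star (lift3 z) ⬝ᵥ (J *ᵥ y₁) = 0) :
    wedge (kmLin y₀ z) (kmLin y₁ z) ≠ 0 := by
  rw [wedge_kmLin_of_jOrth h0 h1]
  exact (map_ne_zero _).2 hab

namespace T4Data

variable (X : T4Data)

/-- **THE KM INTEGRAND IS THE SHAPE INTEGRAND** with `W = W_KM` on the ball (`kmKernel_symm` + `redMaj_eq_of_pos`). -/
theorem kmDilInt_eq_shapeInt (xm : X.Tuple) (h02 : xm 2 = xm 0) (h13 : xm 3 = xm 1)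
    (hpos : ∀ u v : ℂ, (u ≠ 0 ∨ v ≠ 0) →
      0 < (star (u • X.ballCoord (xm 0) + v • X.ballCoord (xm 1)) ⬝ᵥ
        (J *ᵥ (u • X.ballCoord (xm 0) + v • X.ballCoord (xm 1)))).re)
    (α β : ℝ) (z : Fin 2 → ℂ) :
    X.kmDilInt xm α β z = shapeInt (X.ballCoord (xm 0)) (X.ballCoord (xm 1))
      (fun z => wedge (kmLin (X.ballCoord (xm 0)) z) (kmLin (X.ballCoord (xm 1)) z)) α β z := by
  obtain ⟨h0, h1⟩ := X.jpos_slots xm hpos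
  unfold kmDilInt kmGaussFree shapeInt
  rw [X.kmKernel_symm xm h02 h13 z, Complex.ofReal_re, X.redMaj_eq_of_pos xm 0 h0, X.redMaj_eq_of_pos xm 1 h1,
    Complex.normSq_eq_norm_sq, Complex.normSq_eq_norm_sq, norm_mul, mul_pow]
  have hE : Real.exp (-(2 * Real.pi * (maj (X.ballCoord (xm 0)) z + maj (X.ballCoord (xm 1)) z))) *
      Real.exp (2 * Real.pi * (maj (X.ballCoord (xm 0)) z + maj (X.ballCoord (xm 1)) z)) = 1 := by
    rw [← Real.exp_add]; simp
  calc _ = ‖star (lift3 z) ⬝ᵥ (J *ᵥ X.ballCoord (xm 0))‖ ^ 2 * ‖star (lift3 z) ⬝ᵥ (J *ᵥ X.ballCoord (xm 1))‖ ^ 2 /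
        (1 - nsq z) ^ 4 * ‖wedge (kmLin (X.ballCoord (xm 0)) z) (kmLin (X.ballCoord (xm 1)) z)‖ ^ 2 *
        (Real.exp (-(2 * Real.pi * (maj (X.ballCoord (xm 0)) z + maj (X.ballCoord (xm 1)) z))) *
          Real.exp (2 * Real.pi * (maj (X.ballCoord (xm 0)) z + maj (X.ballCoord (xm 1)) z))) *
        Real.exp (-(Real.pi * (α * (2 * ‖star (lift3 z) ⬝ᵥ (J *ᵥ X.ballCoord (xm 0))‖ ^ 2 / (1 - nsq z)) +
          β * (2 * ‖star (lift3 z) ⬝ᵥ (J *ᵥ X.ballCoord (xm 1))‖ ^ 2 / (1 - nsq z))))) := by ring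
    _ = _ := by rw [hE, mul_one]

/-- **THE DATUM-FREE DILATION COMPARISON IS A THEOREM** under `hab` and `hpos` (with `k = 6`). -/
theorem exists_kmDilationComparison (xm : X.Tuple) (h02 : xm 2 = xm 0) (h13 : xm 3 = xm 1)
    (hab : X.ballCoord (xm 0) 0 * X.ballCoord (xm 1) 1 - X.ballCoord (xm 0) 1 * X.ballCoord (xm 1) 0 ≠ 0)
    (hpos : ∀ u v : ℂ, (u ≠ 0 ∨ v ≠ 0) →
      0 < (star (u • X.ballCoord (xm 0) + v • X.ballCoord (xm 1)) ⬝ᵥ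
        (J *ᵥ (u • X.ballCoord (xm 0) + v • X.ballCoord (xm 1)))).re) :
    ∃ A k : ℝ, 0 ≤ A ∧ 0 ≤ k ∧ X.KMDilationComparison xm A k := by
  have hzs := commonZero_mem_ball (X.ballCoord (xm 0)) (X.ballCoord (xm 1)) hab hpos
  have hW0 : wedge (kmLin (X.ballCoord (xm 0)) (commonZero (X.ballCoord (xm 0)) (X.ballCoord (xm 1))))
      (kmLin (X.ballCoord (xm 1)) (commonZero (X.ballCoord (xm 0)) (X.ballCoord (xm 1)))) ≠ 0 :=
    wedge_kmLin_ne_zero_of_jOrth hab (jform_lift3_commonZero_left _ _ hab) (jform_lift3_commonZero_right _ _ hab)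
  obtain ⟨A, k, hA, hk, h⟩ := exists_shape_comparison (X.ballCoord (xm 0)) (X.ballCoord (xm 1)) hab hpos
    (fun z => wedge (kmLin (X.ballCoord (xm 0)) z) (kmLin (X.ballCoord (xm 1)) z))
    (continuousOn_wedge_kmLin _ _) (norm_nonneg _) (by positivity)
    (fun z hz => norm_wedge_kmLin_le _ _ hz) hW0
  refine ⟨A, k, hA, hk, fun lam hlam a b ha ha2 hb hb2 => ?_⟩
  obtain ⟨hint, hle⟩ := h lam hlam a b ha ha2 hb hb2
  have heq : ∀ α β : ℝ, X.kmDilInt xm α β = shapeInt (X.ballCoord (xm 0)) (X.ballCoord (xm 1))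
      (fun z => wedge (kmLin (X.ballCoord (xm 0)) z) (kmLin (X.ballCoord (xm 1)) z)) α β :=
    fun α β => funext fun z => X.kmDilInt_eq_shapeInt xm h02 h13 hpos α β z
  rw [heq, heq]
  exact ⟨hint, hle⟩

/-- **THE CUT `hkRed_ray` WITH NO ANALYTIC HYPOTHESIS:** for every datum `D` and every symmetric centre with
`hab` and `hpos`, the reduced moment bound holds along the whole integer ray with uniform `A, k ≥ 0`
(x2's `hkRed_ray_of_exists_kmDilationComparison`). -/
theorem hkRed_ray_of_plane (D : X.ThetaData) (xm : X.Tuple) (h02 : xm 2 = xm 0) (h13 : xm 3 = xm 1)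
    (hab : X.ballCoord (xm 0) 0 * X.ballCoord (xm 1) 1 - X.ballCoord (xm 0) 1 * X.ballCoord (xm 1) 0 ≠ 0)
    (hpos : ∀ u v : ℂ, (u ≠ 0 ∨ v ≠ 0) →
      0 < (star (u • X.ballCoord (xm 0) + v • X.ballCoord (xm 1)) ⬝ᵥ
        (J *ᵥ (u • X.ballCoord (xm 0) + v • X.ballCoord (xm 1)))).re) :
    ∃ A k : ℝ, 0 ≤ A ∧ 0 ≤ k ∧ ∀ n : ℕ, 1 ≤ n → X.MajorantMomentBoundRed D (X.rayCentre xm n) A k :=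
  X.hkRed_ray_of_exists_kmDilationComparison D xm h02 h13 (X.exists_kmDilationComparison xm h02 h13 hab hpos)

/-- **THE DILATION COMPARISON FOR EVERY DATUM** (the clause of `IsHeckeLocalisablePrintRayWSphD`) is a theorem under
`hab` and `hpos` (x2's `dilationComparison_of_km`). -/
theorem exists_dilationComparison (D : X.ThetaData) (xm : X.Tuple) (h02 : xm 2 = xm 0) (h13 : xm 3 = xm 1)
    (hab : X.ballCoord (xm 0) 0 * X.ballCoord (xm 1) 1 - X.ballCoord (xm 0) 1 * X.ballCoord (xm 1) 0 ≠ 0)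
    (hpos : ∀ u v : ℂ, (u ≠ 0 ∨ v ≠ 0) →
      0 < (star (u • X.ballCoord (xm 0) + v • X.ballCoord (xm 1)) ⬝ᵥ
        (J *ᵥ (u • X.ballCoord (xm 0) + v • X.ballCoord (xm 1)))).re) :
    ∃ A k : ℝ, 0 ≤ A ∧ 0 ≤ k ∧ X.DilationComparison D xm A k := by
  obtain ⟨A, k, hA, hk, h⟩ := X.exists_kmDilationComparison xm h02 h13 hab hpos
  exact ⟨A, k, hA, hk, X.dilationComparison_of_km D xm h⟩

end T4Data

end Summit.Ventures.HodgeRepro.Tier4.Line3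

end
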